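import Summits.ResolutionOfSingularities.ResolutionOfSingularities.Theorems.FrobeniusClosingSteerStrippedThreadLemmas
import Literature.AlgebraicGeometry.Resolution.AdicCompletionRegular
import HarnessLib

/-!
# Stripped threads, part 1b: the exceptional prime of the thread germ, and radicand rings along equivalences

W4.1, crux `Steer` (stmt-ResolutionOfSingularities-16345), σ-line, §σ2.25 v2.1 piece F-A3 `StrippedThreadTwoN` (Θ1♭, res-L0-w41-plan-1
RULING 36; owner res-D-pv-003, consult res-D-pv-011). Theses-free, def-free; sequel of `…StrippedThreadLemmas` (p520316). Contents:

* `prime_excParam_germ` — **the exceptional parameter is a PRIME ELEMENT of the thread germ**: for the step `R → R'` along a centre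
  `P ≤ 𝔪_R` with `R ⧸ P` regular (σ_top-permissible) and exceptional parameter `x`, and a prime `W ∋ x` of `R'`, the element `x` is prime
  in `G = (R')_W ⊆ K` — `R'/(x)` is a regular local ring (tree `NoSingularCarrier.isRegularLocalRing_quotient_span_excParam`), quotient and
  localisation commute, a localisation of a regular ring is regular (Serre), regular local rings are domains;
* `isRegularLocalRing_adjoinRoot_iff_of_locChar` — the radicand ring `R_P[T]/(T^p − f)` read on the ABSTRACT localisation
  `Localization.AtPrime P` (the shape of the skeleton's `IsSingPrime`) and on the CONCRETE one `R_P ⊆ K` (a `locChar` subring) are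
  isomorphic, so regularity transfers (`IsLocalization.algEquiv`, `Ideal.quotientEquiv` along `Polynomial.mapEquiv`);
* `adjoinRoot_equiv_of_ringEquiv` — `A[T]/(g) ≃ B[T]/(g.map e)` along `e : A ≃+* B`;
* `isolated_of_ringEquiv` — the isolatedness clause of `NoEternalStrippedRadicandChain` (every non-maximal prime localises to a regular
  local ring) transports along ring isomorphisms (`IsLocalization.ringEquivOfRingEquiv` on the localisations);
* `isolated_rescale` — hence along the unit rescaling `S[T]/(T^p − f) ≃ S[T]/(T^p − u^p f)` (`T ↦ u T`), the cumulative rescaling of the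
  radicands in the stripped chain (part 3).
OURS (the W4.1 engine); standard commutative algebra. [cite: Matsumura1987, Thm. 14.2, Thm. 19.3] [cite: StacksProject, Tag 07QU]
-/

noncomputable section

-- `Summit.<S>.<S>.…` duplicates the summit name by design (single-problem summit).
set_option linter.dupNamespace false

open Polynomial IsLocalRing Literature.AlgebraicGeometry.Resolution

namespace Summit.ResolutionOfSingularities.ResolutionOfSingularities.Theorems.SwitchingDichotomy.StrippedThread

variable {K : Type} [Field K]

/-! ## §1 Radicand rings along ring equivalences -/

section Equiv

universe v w

/-- **`A[T]/(g) ≃ B[T]/(g.map e)` along a ring isomorphism `e : A ≃ B`.** [folklore] -/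
theorem exists_adjoinRoot_ringEquiv_of_ringEquiv {A : Type v} {B : Type w} [CommRing A] [CommRing B] (e : A ≃+* B) (g : A[X]) :
    ∃ E : AdjoinRoot g ≃+* AdjoinRoot (g.map (e : A →+* B)),
      (∀ a : A, E (AdjoinRoot.of g a) = AdjoinRoot.of _ (e a)) ∧ E (AdjoinRoot.root g) = AdjoinRoot.root _ := by
  have hIJ : Ideal.span {g.map (e : A →+* B)} =
      (Ideal.span {g}).map ((Polynomial.mapEquiv e : A[X] ≃+* B[X]) : A[X] →+* B[X]) := by
    rw [Ideal.map_span, Set.image_singleton]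
    rfl
  refine ⟨Ideal.quotientEquiv (Ideal.span {g}) (Ideal.span {g.map (e : A →+* B)}) (Polynomial.mapEquiv e) hIJ, ?_, ?_⟩
  · intro a
    change Ideal.quotientEquiv _ _ _ hIJ (Ideal.Quotient.mk _ (C a)) = Ideal.Quotient.mk _ (C (e a))
    rw [Ideal.quotientEquiv_mk]
    change Ideal.Quotient.mk _ ((C a).map (e : A →+* B)) = _
    rw [Polynomial.map_C]
    rfl
  · change Ideal.quotientEquiv _ _ _ hIJ (Ideal.Quotient.mk _ X) = Ideal.Quotient.mk _ X
    rw [Ideal.quotientEquiv_mk]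
    change Ideal.Quotient.mk _ ((X : A[X]).map (e : A →+* B)) = _
    rw [Polynomial.map_X]

/-- **The isolatedness clause transports along ring isomorphisms**: if every non-maximal prime of `A` localises to a regular local
ring, the same holds for `B ≃ A`. [folklore] -/
theorem isolated_of_ringEquiv {A : Type v} {B : Type v} [CommRing A] [CommRing B] (e : A ≃+* B)
    (h : ∀ (P : Ideal A) [P.IsPrime], (∃ Q : Ideal A, Q.IsPrime ∧ P < Q) → IsRegularLocalRing (Localization.AtPrime P)) :
    ∀ (P' : Ideal B) [P'.IsPrime], (∃ Q' : Ideal B, Q'.IsPrime ∧ P' < Q') →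
      IsRegularLocalRing (Localization.AtPrime P') := by
  intro P' hP' hQ'
  obtain ⟨Q', hQ'p, hlt⟩ := hQ'
  set P : Ideal A := P'.comap (e : A →+* B) with hPdef
  haveI : P.IsPrime := Ideal.comap_isPrime _ _
  have hQ : ∃ Q : Ideal A, Q.IsPrime ∧ P < Q := by
    refine ⟨Q'.comap (e : A →+* B), Ideal.comap_isPrime _ _, ?_⟩
    refine lt_of_le_of_ne (Ideal.comap_mono hlt.le) fun heq => hlt.ne ?_
    exact Ideal.comap_injective_of_surjective (e : A →+* B) e.surjective heq
  haveI hreg := h P hQ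
  -- `A_P ≃ B_{P'}`
  have hM : P.primeCompl.map e.toMonoidHom = P'.primeCompl := by
    ext b
    constructor
    · rintro ⟨a, ha, rfl⟩
      exact fun hb => ha (show a ∈ P from hb)
    · intro hb
      refine ⟨e.symm b, fun ha => hb ?_, e.apply_symm_apply b⟩
      have : e (e.symm b) ∈ P' := ha
      rwa [e.apply_symm_apply] at this
  exact IsRegularLocalRing.of_ringEquiv
    (IsLocalization.ringEquivOfRingEquiv (Localization.AtPrime P) (Localization.AtPrime P') e hM)

/-- **The isolatedness clause is invariant under unit rescaling of the radicand**: `S[T]/(T^p − f) ≃ S[T]/(T^p − u^p·f)` for a unit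
`u` (`T ↦ u·T`), so if every non-maximal prime of the first localises to a regular local ring, so does every non-maximal prime of the
second. OURS bookkeeping (the cumulative rescaling `f k = c_k^p · s^p` of the stripped chain). [folklore] -/
theorem isolated_rescale {S : Type v} [CommRing S] (p : ℕ) {u f f' : S} (hu : IsUnit u) (hf' : f' = u ^ p * f)
    (h : ∀ (P : Ideal (AdjoinRoot (X ^ p - C f : S[X]))) [P.IsPrime],
      (∃ Q : Ideal (AdjoinRoot (X ^ p - C f : S[X])), Q.IsPrime ∧ P < Q) → IsRegularLocalRing (Localization.AtPrime P)) :
    ∀ (P' : Ideal (AdjoinRoot (X ^ p - C f' : S[X]))) [P'.IsPrime],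
      (∃ Q' : Ideal (AdjoinRoot (X ^ p - C f' : S[X])), Q'.IsPrime ∧ P' < Q') →
        IsRegularLocalRing (Localization.AtPrime P') := by
  obtain ⟨v, hv⟩ := hu.exists_left_inv
  set F : S[X] := X ^ p - C f with hF
  set F' : S[X] := X ^ p - C f' with hF'
  have hrootF : AdjoinRoot.mk F (X ^ p) = AdjoinRoot.of F f := by
    have h0 : AdjoinRoot.mk F (X ^ p - C f) = 0 := by rw [← hF]; exact AdjoinRoot.mk_self
    rw [map_sub, sub_eq_zero, AdjoinRoot.mk_C] at h0
    exact h0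
  have hrootF' : AdjoinRoot.mk F' (X ^ p) = AdjoinRoot.of F' f' := by
    have h0 : AdjoinRoot.mk F' (X ^ p - C f') = 0 := by rw [← hF']; exact AdjoinRoot.mk_self
    rw [map_sub, sub_eq_zero, AdjoinRoot.mk_C] at h0
    exact h0
  -- `a = u·T` in `S[T]/(F)` is a root of `F'`; `b = v·T` in `S[T]/(F')` is a root of `F`
  set a : AdjoinRoot F := AdjoinRoot.mk F (C u * X) with ha
  set b : AdjoinRoot F' := AdjoinRoot.mk F' (C v * X) with hb
  have hapow : a ^ p = AdjoinRoot.of F f' := by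
    rw [ha, ← map_pow, mul_pow, ← C_pow, map_mul, AdjoinRoot.mk_C, hrootF, hf', map_mul, map_pow]
  have hbpow : b ^ p = AdjoinRoot.of F' f := by
    rw [hb, ← map_pow, mul_pow, ← C_pow, map_mul, AdjoinRoot.mk_C, hrootF', hf']
    simp only [map_mul, map_pow]
    have hvu : AdjoinRoot.of F' v ^ p * AdjoinRoot.of F' u ^ p = 1 := by
      rw [← mul_pow, ← map_mul, hv, map_one, one_pow]
    linear_combination (AdjoinRoot.of F' f) * hvu
  have haev : F'.eval₂ (algebraMap S (AdjoinRoot F)) a = 0 := by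
    rw [hF', eval₂_sub, eval₂_X_pow, eval₂_C, hapow, AdjoinRoot.algebraMap_eq, sub_self]
  have hbev : F.eval₂ (algebraMap S (AdjoinRoot F')) b = 0 := by
    rw [hF, eval₂_sub, eval₂_X_pow, eval₂_C, hbpow, AdjoinRoot.algebraMap_eq, sub_self]
  let φ : AdjoinRoot F' →ₐ[S] AdjoinRoot F := AdjoinRoot.liftAlgHom F' (Algebra.ofId S _) a haev
  let ψ : AdjoinRoot F →ₐ[S] AdjoinRoot F' := AdjoinRoot.liftAlgHom F (Algebra.ofId S _) b hbev
  have hφroot : φ (AdjoinRoot.root F') = a := AdjoinRoot.liftAlgHom_root _ _ _ _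
  have hψroot : ψ (AdjoinRoot.root F) = b := AdjoinRoot.liftAlgHom_root _ _ _ _
  have hφof : ∀ r : S, φ (AdjoinRoot.of F' r) = AdjoinRoot.of F r := fun r => AdjoinRoot.liftAlgHom_of _ _ _ _ r
  have hψof : ∀ r : S, ψ (AdjoinRoot.of F r) = AdjoinRoot.of F' r := fun r => AdjoinRoot.liftAlgHom_of _ _ _ _ r
  have ha' : a = AdjoinRoot.of F u * AdjoinRoot.root F := by
    rw [ha, map_mul, AdjoinRoot.mk_C, AdjoinRoot.mk_X]
  have hb' : b = AdjoinRoot.of F' v * AdjoinRoot.root F' := by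
    rw [hb, map_mul, AdjoinRoot.mk_C, AdjoinRoot.mk_X]
  have hφψ : φ.comp ψ = AlgHom.id S _ := by
    refine AdjoinRoot.algHom_ext ?_
    rw [AlgHom.comp_apply, AlgHom.id_apply, hψroot, hb', map_mul, hφof, hφroot, ha']
    have : AdjoinRoot.of F v * AdjoinRoot.of F u = 1 := by rw [← map_mul, hv, map_one]
    linear_combination (AdjoinRoot.root F) * this
  have hψφ : ψ.comp φ = AlgHom.id S _ := by
    refine AdjoinRoot.algHom_ext ?_
    rw [AlgHom.comp_apply, AlgHom.id_apply, hφroot, ha', map_mul, hψof, hψroot, hb']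
    have : AdjoinRoot.of F' u * AdjoinRoot.of F' v = 1 := by rw [← map_mul, mul_comm, hv, map_one]
    linear_combination (AdjoinRoot.root F') * this
  let e : AdjoinRoot F ≃ₐ[S] AdjoinRoot F' := AlgEquiv.ofAlgHom ψ φ hψφ hφψ
  exact isolated_of_ringEquiv e.toRingEquiv h

end Equiv

/-! ## §2 The radicand ring over the abstract and the concrete local ring -/

section Transfer

variable {R D : Subring K} {P : Ideal R} [hP : P.IsPrime]
  (hD : ∀ z : K, z ∈ D ↔ ∃ a b : R, b ∉ P ∧ z = (a : K) / b)
include hD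

/-- **`R_P[T]/(T^p − f)` on `Localization.AtPrime P` and on `R_P ⊆ K` agree**: regularity of the radicand ring over the abstract
localisation (the skeleton's `IsSingPrime R p f P` body) is equivalent to regularity over the `locChar` subring `D = R_P`.
[folklore] -/
theorem isRegularLocalRing_adjoinRoot_iff_of_locChar (p : ℕ) (f : R) :
    IsRegularLocalRing (AdjoinRoot ((X : (Localization.AtPrime P)[X]) ^ p -
        C (algebraMap R (Localization.AtPrime P) f))) ↔
      IsRegularLocalRing (AdjoinRoot ((X : D[X]) ^ p - C (⟨(f : K), GeoDict.le_of_locChar hD f.2⟩ : D))) := by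
  letI : Algebra R D := (Subring.inclusion (GeoDict.le_of_locChar hD)).toAlgebra
  haveI : IsLocalization.AtPrime D P := GeoDict.isLocalization_of_locChar hD fun r => rfl
  let e : Localization.AtPrime P ≃ₐ[R] D := IsLocalization.algEquiv P.primeCompl (Localization.AtPrime P) D
  have hef : e.toRingEquiv (algebraMap R (Localization.AtPrime P) f) = ⟨(f : K), GeoDict.le_of_locChar hD f.2⟩ := by
    change e (algebraMap R (Localization.AtPrime P) f) = algebraMap R D f
    exact e.commutes f
  obtain ⟨E, -, -⟩ := exists_adjoinRoot_ringEquiv_of_ringEquiv e.toRingEquiv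
    ((X : (Localization.AtPrime P)[X]) ^ p - C (algebraMap R (Localization.AtPrime P) f))
  have hmap : ((X : (Localization.AtPrime P)[X]) ^ p - C (algebraMap R (Localization.AtPrime P) f)).map
      (e.toRingEquiv : Localization.AtPrime P →+* D) =
      (X : D[X]) ^ p - C (⟨(f : K), GeoDict.le_of_locChar hD f.2⟩ : D) := by
    rw [Polynomial.map_sub, Polynomial.map_pow, Polynomial.map_X, Polynomial.map_C]
    congr 2
  rw [hmap] at E
  exact ⟨fun h => by haveI := h; exact IsRegularLocalRing.of_ringEquiv E,
    fun h => by haveI := h; exact IsRegularLocalRing.of_ringEquiv E.symm⟩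

end Transfer

/-! ## §3 The exceptional parameter is a prime element of the thread germ -/

section ExcPrime

variable {O : ValuationSubring K} {R R' : Subring K} [IsRegularLocalRing R] {P : Ideal R}

/-- **The exceptional parameter of a step along a regular centre is PRIME in the germ at any prime containing it.** Let `R ⊆ K` be a
regular local subring dominated by `O` (`a ∈ 𝔪_R ↔ v(a) < 1`), `P ≤ 𝔪_R` with `R ⧸ P` regular, `R'` the local blowing up of `R` along
`P` with respect to `O`, `x` an exceptional parameter along `P`, `W` a prime of `R'` containing `x`, and `G = (R')_W ⊆ K` its local
ring (`locChar`). Then `x` is a prime element of `G`: `R'/(x)` is a regular local ring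
(`NoSingularCarrier.isRegularLocalRing_quotient_span_excParam`), `G/(x)` is its localisation at `W/(x)` — quotient and localisation
commute — hence regular (Serre), hence a domain. [cite: Matsumura1987, Thm. 14.2, Thm. 19.3] [cite: StacksProject, Tag 07QU] -/
theorem prime_excParam_germ (hval : ∀ a : R, a ∈ maximalIdeal R ↔ O.valuation (a : K) < 1)
    (hP : P ≤ maximalIdeal R) [IsRegularLocalRing (R ⧸ P)]
    (hbl : IsLocalBlowupAlong O R P R') {x : K}
    (hx : (∃ hxR : x ∈ R, (⟨x, hxR⟩ : R) ∈ P) ∧ x ≠ 0 ∧ ∀ y : R, y ∈ P → O.valuation (y : K) ≤ O.valuation x)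
    {W : Ideal R'} [hW : W.IsPrime] {G : Subring K} (hG : ∀ z : K, z ∈ G ↔ ∃ a b : R', b ∉ W ∧ z = (a : K) / b)
    (hxW : ∃ hxR' : x ∈ R', (⟨x, hxR'⟩ : R') ∈ W) :
    Prime (⟨x, GeoDict.le_of_locChar hG hxW.fst⟩ : G) := by
  obtain ⟨hxR', hreg⟩ := NoSingularCarrier.isRegularLocalRing_quotient_span_excParam hval hP hbl hx
  have hxWmem : (⟨x, hxR'⟩ : R') ∈ W := hxW.snd
  have hx0 : x ≠ 0 := hx.2.1
  letI : Algebra R' G := (Subring.inclusion (GeoDict.le_of_locChar hG)).toAlgebra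
  haveI : IsLocalization.AtPrime G W := GeoDict.isLocalization_of_locChar hG fun r => rfl
  set J : Ideal R' := Ideal.span {(⟨x, hxR'⟩ : R')} with hJ
  haveI : IsRegularLocalRing (R' ⧸ J) := hreg
  have hJW : J ≤ W := (Ideal.span_singleton_le_iff_mem _).mpr hxWmem
  -- the prime `W/J` of `R'/J`
  set Wbar : Ideal (R' ⧸ J) := W.map (Ideal.Quotient.mk J) with hWbar
  have hcomap : Wbar.comap (Ideal.Quotient.mk J) = W := by
    rw [hWbar, Ideal.comap_map_of_surjective _ Ideal.Quotient.mk_surjective,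
      ← RingHom.ker_eq_comap_bot, Ideal.mk_ker, sup_eq_left]
    exact hJW
  haveI hWbarp : Wbar.IsPrime :=
    Ideal.map_isPrime_of_surjective Ideal.Quotient.mk_surjective (by rwa [Ideal.mk_ker])
  have hmemW : ∀ c : R', Ideal.Quotient.mk J c ∈ Wbar ↔ c ∈ W := fun c => by
    rw [← Ideal.mem_comap, hcomap]
  have hM : Algebra.algebraMapSubmonoid (R' ⧸ J) W.primeCompl = Wbar.primeCompl := by
    ext b
    constructor
    · rintro ⟨c, hc, rfl⟩
      exact fun h => hc ((hmemW c).mp h)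
    · intro hb
      obtain ⟨c, rfl⟩ := Ideal.Quotient.mk_surjective b
      exact ⟨c, fun h => hb ((hmemW c).mpr h), rfl⟩
  -- quotient and localisation commute
  haveI : IsLocalization.AtPrime (G ⧸ J.map (algebraMap R' G)) Wbar := by
    have := (inferInstance : IsLocalization (Algebra.algebraMapSubmonoid (R' ⧸ J) W.primeCompl)
      (G ⧸ J.map (algebraMap R' G)))
    rwa [hM] at this
  have e := (IsLocalization.algEquiv Wbar.primeCompl (G ⧸ J.map (algebraMap R' G))
    (Localization.AtPrime Wbar)).toRingEquiv
  haveI : IsRegularRing (R' ⧸ J) := isRegularRing_of_isRegularLocalRing _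
  haveI hloc : IsRegularLocalRing (Localization.AtPrime Wbar) :=
    IsRegularRing.isRegularLocalRing_localization (R := R' ⧸ J) Wbar
  haveI hregGJ : IsRegularLocalRing (G ⧸ J.map (algebraMap R' G)) :=
    IsRegularLocalRing.of_ringEquiv (R := Localization.AtPrime Wbar) e.symm
  -- `J·G = (x)` and `G/(x)` is a domain
  have hJG : J.map (algebraMap R' G) = Ideal.span {(⟨x, GeoDict.le_of_locChar hG hxW.fst⟩ : G)} := by
    rw [hJ, Ideal.map_span, Set.image_singleton]
    rfl
  haveI : IsDomain (G ⧸ Ideal.span {(⟨x, GeoDict.le_of_locChar hG hxW.fst⟩ : G)}) := by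
    rw [← hJG]
    exact isDomain_of_isRegularLocalRing _
  have hx0G : (⟨x, GeoDict.le_of_locChar hG hxW.fst⟩ : G) ≠ 0 := fun h => hx0 (congrArg Subtype.val h)
  exact (Ideal.span_singleton_prime hx0G).mp ((Ideal.Quotient.isDomain_iff_prime _).mp inferInstance)

end ExcPrime

end Summit.ResolutionOfSingularities.ResolutionOfSingularities.Theorems.SwitchingDichotomy.StrippedThread

end
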